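import Summits.QuantumFields.YangMills.Theorems.CurvatureSandwichBound.Negative.ConstFieldOS

/-!
# `CurvatureSandwichBound` (Σ) — negative-side support VII: the CONVEXITY BARRIER — clustering / the gap are
load-bearing for the model-blind core

Support file for crux `stmt-QuantumFields-18372` (lead prover c2, line `Sketch`).  Tree objects only; nothing is posited.

Every hypothesis of the model-blind core `SandwichModelBlind` EXCEPT E4 (clustering) and the continuum gap is preserved
under convex combinations (mixtures) of Schwinger families — E0, hermiticity, E0', E2 in every frame, E3, translations,
hypercubic invariance, the planar cone, the soft kernel — while the conclusion `SandwichRows` is not.  The witness is the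
**random constant field** with an exponentially distributed amplitude,
`𝔖ₙ(F) = (∫₀^∞ κⁿ e^{-κ} dκ) ∫F = n! ∫F` (`factField`), the mixture of the certified inhabitants `constField κ`:

* `factField_pullback_isReflectionPositive`: E2 in EVERY frame, from the Gram identity
  `(p+q)! = ∑ₖ (p!·C(p,k))·(q!·C(q,k))` (Chu–Vandermonde), so `∑ᵢⱼ (dᵢ+dⱼ)! conj(cᵢ) cⱼ = ∑ₖ |∑ⱼ dⱼ! C(dⱼ,k) cⱼ|² ≥ 0`;
* `hasLinearGrowth_factField` (E0' with `β = 2`), `planarCone_factField` (`((n+m)!)² ≤ (2n)!(2m)!`),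
  `softKernel_factField` (`K ≡ 2`), normalisation, hermiticity, symmetry, translations, hypercubic invariance;
* `osReconstruction_factField`, `norm_fieldVec_factField_sq` (`‖Ψ_F‖² = (2n)! |∫F|²`), `factField_cluster_defect`
  (what fails: E4 / the gap — the clustered quantity is `((n+m)! − n!m!) conj(∫F)∫G`, constant in the separation).
The failure of the rows and the barrier theorem are in support file VIII (`ConvexityBarrier.lean`).

MEANING for the crux: a model-blind proof of Σ must use E4 or the mass gap (uniqueness of the vacuum) in an essential,
non-convex way; reflection-positivity / Schwarz / planar-cone manipulations alone — all stable under mixtures — can never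
reach the rows (they hold in each `constField κ` with constant `|κ|/2`, unbounded over the mixture).  This corrects the
standing disprover's §3e ("E4, gap: no known role in the `e₀` row").
-/

noncomputable section

namespace Summit.QuantumFields.YangMills.Theorems.CurvatureSandwichBound.Negative

open scoped BigOperators SchwartzMap ComplexConjugate InnerProductSpace ENNReal
open MeasureTheory Filter Topology Complex
open Literature.MathematicalPhysics.QuantumLattice Literature.MathematicalPhysics.AQFT
  Literature.MathematicalPhysics.QuantumFieldTheory
open Summit.QuantumFields.YangMills.Theorems.NPointIsotropy.Negative (E4)
open Summit.QuantumFields.YangMills.Theorems.CurvatureBoostCovariance.Negative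
  (OSPackage Translations Hypercubic EightFrameRP PlanarCone)
open Summit.QuantumFields.YangMills.Theorems.SoftKernelBoostCovariance.Negative (SoftKernel)
open Summit.QuantumFields.YangMills.Theorems.DiagonalMirrorRPR.Negative
  (integ integ_apply integral_linActMulti integral_appendTensor integral_osAdjoint)

variable {n m : ℕ}

/-! ## §1 The random constant field `𝔖ₙ(F) = n! ∫ F` -/

/-- **The random constant field with `Exp(1)`-distributed amplitude**: `𝔖ₙ(F) = n! ∫F`
(`n! = ∫₀^∞ κⁿ e^{-κ} dκ`: the mixture `∫ constField κ · e^{-κ} dκ` of constant fields). -/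
def factField : SchwingerFamily E4 := fun n => ((n.factorial : ℕ) : ℂ) • integ n

/-- `factField n F = n! ∫ F`. -/
theorem factField_apply (F : 𝓢((Fin n → E4), ℂ)) :
    factField n F = ((n.factorial : ℕ) : ℂ) * ∫ x, F x := by
  simp [factField, integ_apply]

/-- Pulling the random constant field back by a linear isometry gives the same family. -/
theorem factField_pullback (R : E4 ≃ₗᵢ[ℝ] E4) :
    (fun n => (factField n).comp (linActMulti R)) = factField := by
  funext n
  ext F
  rw [ContinuousLinearMap.comp_apply, factField_apply, factField_apply, integral_linActMulti]

/-! ## §2 Two factorial inequalities / identities -/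

/-- **Chu–Vandermonde in Gram form**: `(p+q)! = ∑_{k<B} (p!·C(p,k))·(q!·C(q,k))` whenever `p < B`
(the Hankel matrix of the factorials is `L Lᵀ` with `L_{pk} = p! C(p,k)`). -/
theorem factorial_add_eq_sum_range (p q B : ℕ) (hp : p < B) :
    (p + q).factorial = ∑ k ∈ Finset.range B, (p.factorial * p.choose k) * (q.factorial * q.choose k) := by
  -- `C(p+q, p) = ∑_{k ≤ p} C(p,k) C(q,k)`
  have h1 : (p + q).choose p = ∑ k ∈ Finset.range (p + 1), p.choose k * q.choose k := by
    rw [Nat.add_choose_eq, Finset.Nat.sum_antidiagonal_eq_sum_range_succ_mk]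
    rw [← Finset.sum_range_reflect (fun k => p.choose k * q.choose k) (p + 1)]
    refine Finset.sum_congr rfl fun k hk => ?_
    have hk' : k ≤ p := Nat.lt_succ_iff.mp (Finset.mem_range.mp hk)
    have e : p + 1 - 1 - k = p - k := by omega
    rw [e, Nat.choose_symm hk']
  -- extend the range: the extra terms vanish
  have h2 : ∑ k ∈ Finset.range (p + 1), p.choose k * q.choose k =
      ∑ k ∈ Finset.range B, p.choose k * q.choose k := by
    refine Finset.sum_subset (fun k hk => Finset.mem_range.2
      (lt_of_lt_of_le (Finset.mem_range.1 hk) (Nat.succ_le_of_lt hp))) fun k hkB hk => ?_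
    have hpk : p < k := by
      have := Finset.mem_range.not.mp hk
      omega
    rw [Nat.choose_eq_zero_of_lt hpk, zero_mul]
  have h3 : (p + q).factorial = (p + q).choose p * p.factorial * q.factorial := by
    rw [Nat.choose_symm_add]
    exact (Nat.add_choose_mul_factorial_mul_factorial p q).symm
  rw [h3, h1, h2, Finset.sum_mul, Finset.sum_mul]
  refine Finset.sum_congr rfl fun k _ => ?_
  ring

/-- **Log-convexity of the factorials at even arguments**: `((n+m)!)² ≤ (2n)! (2m)!` (the central binomial coefficient
is the largest: `C(2n+2m, 2n) ≤ C(2n+2m, n+m)`). -/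
theorem factorial_add_sq_le (n m : ℕ) :
    (n + m).factorial * (n + m).factorial ≤ (n + n).factorial * (m + m).factorial := by
  set N := n + m with hN
  have hNN : N + N = (n + n) + (m + m) := by omega
  have h1 : (N + N).choose (n + n) * (n + n).factorial * (m + m).factorial = (N + N).factorial := by
    have h := Nat.choose_mul_factorial_mul_factorial (show n + n ≤ N + N by omega)
    rwa [show N + N - (n + n) = m + m by omega] at h
  have h2 : (N + N).choose N * N.factorial * N.factorial = (N + N).factorial := by
    have h := Nat.choose_mul_factorial_mul_factorial (show N ≤ N + N by omega)
    rwa [show N + N - N = N by omega] at h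
  have h3 : (N + N).choose (n + n) ≤ (N + N).choose N := by
    have h := Nat.choose_le_middle (n + n) (N + N)
    rwa [show (N + N) / 2 = N by omega] at h
  have hpos : 0 < (N + N).choose N := Nat.choose_pos (by omega)
  have key : (N + N).choose N * (N.factorial * N.factorial) ≤
      (N + N).choose N * ((n + n).factorial * (m + m).factorial) :=
    calc (N + N).choose N * (N.factorial * N.factorial) = (N + N).factorial := by rw [← h2]; ring
      _ = (N + N).choose (n + n) * ((n + n).factorial * (m + m).factorial) := by rw [← h1]; ring
      _ ≤ (N + N).choose N * ((n + n).factorial * (m + m).factorial) := Nat.mul_le_mul_right _ h3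
  exact Nat.le_of_mul_le_mul_left key hpos

/-! ## §3 The convex clauses of the hypotheses -/

/-- E0 (normalisation): `0! ∫_{(ℝ⁴)⁰} F = F()`. -/
theorem isNormalized_factField : factField.toLabelled.IsNormalized := by
  intro k F
  rw [SchwingerFamily.toLabelled_apply, factField_apply, integral_finZero_eq_apply, Nat.factorial_zero, Nat.cast_one,
    one_mul]
  exact congrArg F (Subsingleton.elim _ _)

/-- E0 (hermiticity): `n! ∫F = conj (n! ∫ θF*)`. -/
theorem isHermitian_factField : factField.toLabelled.IsHermitian := by
  intro n k F _
  rw [SchwingerFamily.toLabelled_apply, SchwingerFamily.toLabelled_apply, factField_apply, factField_apply,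
    integral_osAdjoint, map_mul, map_natCast, Complex.conj_conj]

/-- **E0' (linear growth)**: order `s = 5`, `α = e^{32 J}`, `β = 2` (`|n! ∫F| ≤ n! (32 J)ⁿ |F|_{5n} ≤ e^{32J} (n!)² |F|_{5n}`). -/
theorem hasLinearGrowth_factField : factField.toLabelled.HasLinearGrowth := by
  intro T
  refine ⟨5, Real.exp (32 * J4), 2, fun n k _ F _ => ?_⟩
  rw [SchwingerFamily.toLabelled_apply, factField_apply, norm_mul, Complex.norm_natCast]
  have hN : 0 ≤ schwartzNorm (n * 5) F := schwartzNorm_nonneg _ _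
  have hc : 0 ≤ 32 * J4 := by have := J4_nonneg; positivity
  have hfac : (32 * J4) ^ n ≤ Real.exp (32 * J4) * n.factorial := by
    have h := Real.pow_div_factorial_le_exp _ hc n
    rwa [div_le_iff₀ (by positivity)] at h
  have hn0 : (0 : ℝ) ≤ n.factorial := Nat.cast_nonneg _
  calc (n.factorial : ℝ) * ‖∫ x, F x‖ ≤ n.factorial * ((32 * J4) ^ n * schwartzNorm (n * 5) F) :=
        mul_le_mul_of_nonneg_left ((norm_integral_le_integral_norm _).trans (integral_norm_le_schwartzNorm F)) hn0
    _ ≤ n.factorial * (Real.exp (32 * J4) * n.factorial * schwartzNorm (n * 5) F) :=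
        mul_le_mul_of_nonneg_left (mul_le_mul_of_nonneg_right hfac hN) hn0
    _ = Real.exp (32 * J4) * (n.factorial : ℝ) ^ (2 : ℝ) * schwartzNorm (n * 5) F := by
        rw [Real.rpow_two]; ring

/-- E3 (symmetry). -/
theorem isSymmetric_factField : factField.toLabelled.IsSymmetric := by
  intro n k π F _
  rw [SchwingerFamily.toLabelled_apply, SchwingerFamily.toLabelled_apply, factField_apply, factField_apply,
    integral_permTest]

/-- Translation invariance (on all of `𝓢`). -/
theorem translations_factField : Translations factField := fun n a F _ => by
  rw [factField_apply, factField_apply, integral_translateMulti]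

/-- Invariance under every linear isometry (a fortiori proper hypercubic invariance on `⁰𝒮`). -/
theorem hypercubic_factField : Hypercubic factField := fun R _ _ n F _ => by
  rw [factField_apply, factField_apply, integral_linActMulti]

/-- **E2 in EVERY frame for the random constant field.**  With `cⱼ = ∫ Fⱼ` and `dⱼ = deg j`,
`∑ᵢⱼ (dᵢ+dⱼ)! conj(cᵢ) cⱼ = ∑ₖ |∑ⱼ dⱼ! C(dⱼ,k) cⱼ|² ≥ 0` by the Gram form of Chu–Vandermonde. -/
theorem factField_pullback_isReflectionPositive (R : E4 ≃ₗᵢ[ℝ] E4) :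
    (SchwingerFamily.toLabelled (fun n => (factField n).comp (linActMulti R))).IsReflectionPositive := by
  intro N deg lab F hF H hH
  set B : ℕ := ∑ i, deg i + 1 with hB
  have hdeg : ∀ i, deg i < B := fun i => by
    have : deg i ≤ ∑ j, deg j := Finset.single_le_sum (fun j _ => Nat.zero_le (deg j)) (Finset.mem_univ i)
    omega
  let w : ℕ → Fin N → ℂ := fun k j => (((deg j).factorial * (deg j).choose k : ℕ) : ℂ) * ∫ x, F j x
  have hterm : ∀ i j, (SchwingerFamily.toLabelled (fun n => (factField n).comp (linActMulti R)))
      (deg i + deg j) (Fin.append (lab i ∘ Fin.rev) (lab j)) (H i j) =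
        ∑ k ∈ Finset.range B, conj (w k i) * w k j := by
    intro i j
    rw [SchwingerFamily.toLabelled_apply, ContinuousLinearMap.comp_apply, factField_apply, integral_linActMulti,
      integral_appendTensor (hH i j), integral_osAdjoint, factorial_add_eq_sum_range (deg i) (deg j) B (hdeg i),
      Nat.cast_sum, Finset.sum_mul]
    refine Finset.sum_congr rfl fun k _ => ?_
    simp only [w, map_mul, map_natCast, Nat.cast_mul]
    ring
  have hinner : ∀ k, ∑ i, ∑ j, conj (w k i) * w k j = ((‖∑ j, w k j‖ ^ 2 : ℝ) : ℂ) := by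
    intro k
    rw [← Finset.sum_mul_sum, ← map_sum, Complex.conj_mul']
    push_cast
    rfl
  have hz : ∑ i, ∑ j, (SchwingerFamily.toLabelled (fun n => (factField n).comp (linActMulti R)))
      (deg i + deg j) (Fin.append (lab i ∘ Fin.rev) (lab j)) (H i j) =
        ((∑ k ∈ Finset.range B, ‖∑ j, w k j‖ ^ 2 : ℝ) : ℂ) := by
    simp only [hterm]
    rw [Finset.sum_congr rfl fun i _ => Finset.sum_comm, Finset.sum_comm]
    rw [Complex.ofReal_sum]
    exact Finset.sum_congr rfl fun k _ => hinner k
  simp only []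
  rw [hz, Complex.ofReal_re, Complex.ofReal_im]
  exact ⟨Finset.sum_nonneg fun k _ => sq_nonneg _, rfl⟩

/-- E2 along `e₀` (the identity frame). -/
theorem isReflectionPositive_factField : factField.toLabelled.IsReflectionPositive := by
  have h := factField_pullback_isReflectionPositive (LinearIsometryEquiv.refl ℝ E4)
  rwa [factField_pullback] at h

/-- RP in the eight planar frames (indeed in every frame). -/
theorem eightFrameRP_factField : EightFrameRP factField :=
  fun R _ _ _ _ _ => factField_pullback_isReflectionPositive R

/-- **The planar cone of the random constant field**: `Φ ≡ (n+m)! conj(∫F) ∫G` (entire), and the Cauchy–Schwarz bound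
is `((n+m)!)² ≤ (2n)!(2m)!`. -/
theorem planarCone_factField : PlanarCone factField := by
  intro n m F G _ _
  refine ⟨fun _ => (((n + m).factorial : ℕ) : ℂ) * ((starRingEnd ℂ) (∫ x, F x) * ∫ x, G x),
    differentiableOn_const _, fun t b _ H hH => ?_, fun w _ HF HG hHF hHG => ?_⟩
  · rw [factField_apply, integral_appendTensor hH, integral_osAdjoint, integral_translateMulti]
  · rw [factField_apply, factField_apply, integral_appendTensor hHF, integral_appendTensor hHG,
      integral_osAdjoint, integral_osAdjoint]
    simp only [norm_mul, Complex.norm_natCast, Complex.norm_conj]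
    have key : ((n + m).factorial : ℝ) ^ 2 ≤ (n + n).factorial * (m + m).factorial := by
      rw [sq]; exact_mod_cast factorial_add_sq_le n m
    have hab : 0 ≤ (‖∫ x, F x‖ * ‖∫ x, G x‖) ^ 2 := sq_nonneg _
    calc (((n + m).factorial : ℝ) * (‖∫ x, F x‖ * ‖∫ x, G x‖)) ^ 2
        = ((n + m).factorial : ℝ) ^ 2 * (‖∫ x, F x‖ * ‖∫ x, G x‖) ^ 2 := by ring
      _ ≤ ((n + n).factorial * (m + m).factorial) * (‖∫ x, F x‖ * ‖∫ x, G x‖) ^ 2 :=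
          mul_le_mul_of_nonneg_right key hab
      _ = (n + n).factorial * (‖∫ x, F x‖ * ‖∫ x, F x‖) * ((m + m).factorial * (‖∫ x, G x‖ * ‖∫ x, G x‖)) := by
          ring

/-- **The soft kernel of the random constant field**: `K ≡ 2 = 2!`, `C = 2`, `η = 1`. -/
theorem softKernel_factField : SoftKernel factField := by
  refine ⟨fun _ => 2, 2, 1, one_pos, continuousOn_const, fun x _ => ?_, fun F _ => ⟨?_, ?_⟩⟩
  · rw [abs_of_nonneg (by norm_num : (0 : ℝ) ≤ 2)]
    have h : (0 : ℝ) ≤ ‖x‖ ^ ((1 : ℝ) - 10) := Real.rpow_nonneg (norm_nonneg _) _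
    nlinarith
  · exact F.integrable.const_mul _
  · rw [factField_apply, integral_const_mul]
    norm_num [Nat.factorial]

/-- The continuum-gap / E4 clauses are exactly what fails: the clustered quantity is `((n+m)! − n! m!) conj(∫F) ∫G`,
constant in the separation (recorded; not needed below). -/
theorem factField_cluster_defect (F : 𝓢((Fin n → E4), ℂ)) (G : 𝓢((Fin m → E4), ℂ)) (a : E4)
    {H : 𝓢((Fin (n + m) → E4), ℂ)} (hH : IsAppendTensorOf H (osAdjoint F) (translateMulti a G)) :
    factField (n + m) H - factField n (osAdjoint F) * factField m G =
      ((((n + m).factorial : ℕ) : ℂ) - (n.factorial : ℕ) * (m.factorial : ℕ)) * (conj (∫ x, F x) * ∫ x, G x) := by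
  rw [factField_apply, factField_apply, factField_apply, integral_appendTensor hH, integral_osAdjoint,
    integral_translateMulti]
  ring

/-! ## §4 The `e₀`-reconstruction and the norms of field vectors -/

/-- The `e₀`-reconstruction premises hold for the random constant field. -/
theorem osReconstruction_factField : OSReconstructionNoE1 factField.toLabelled :=
  ⟨isReflectionPositive_factField, fun n _ a F _ => by
    rw [SchwingerFamily.toLabelled_apply, factField_apply, factField_apply, integral_translateMulti]⟩

/-- **`‖Ψ_F‖² = (2n)! |∫ F|²`** for the random constant field (`F` of degree `n`). -/
theorem norm_fieldVec_factField_sq (h : OSReconstructionNoE1 factField.toLabelled)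
    (F : 𝓢((Fin n → E4), ℂ)) (hF : IsTimeOrdered F) :
    ‖h.fieldVec n (fun _ => ()) F hF‖ ^ 2 = (n + n).factorial * ‖∫ x, F x‖ ^ 2 := by
  have h2 := norm_fieldVec_sq h F hF
  rw [factField_apply, integral_appendTensor (isAppendTensorOf_appendTensor _ _), integral_osAdjoint,
    Complex.conj_mul'] at h2
  have e : (((n + n).factorial : ℕ) : ℂ) * ((‖∫ x, F x‖ : ℂ) ^ 2) =
      (((n + n).factorial * ‖∫ x, F x‖ ^ 2 : ℝ) : ℂ) := by
    push_cast; ring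
  rw [e, Complex.ofReal_re] at h2
  exact h2

end Summit.QuantumFields.YangMills.Theorems.CurvatureSandwichBound.Negative

end
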